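import Literature.IUT.HodgeArakelov.AbsTopMonoidsGenuineZHatNaturalityUnits
import Literature.IUT.HodgeArakelov.GaloisPairRigidityRmk1111bKernel
import HarnessLib

/-!
# [IUTchII] Rmk 1.11.1 (ii) / (i) (b) at the genuine producers: the isomorphisms of pairs `G ↷ O^×(G)` are EXACTLY the
# `Ẑ^×`-multiples of the induced ones; `Aut(G ↷ O^×(G)) = Aut(G) × Ẑ^×` canonically (proof-only)

S. Mochizuki, *Inter-universal Teichmüller theory II*, §1, Remark 1.11.1, kurims manuscript (Dec. 2020) p. 50: (i) (b)
«in the case of (∗×), the group of automorphisms of the MLF-Galois TM-pair `G ↷ O^×(G)` maps surjectively … onto the group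
of automorphisms of the topological group `G`, with kernel given by the [`G`-linear] automorphisms … determined by the
natural action of `Ẑ^×`»; (ii) «allowing for a `Γ (= Ẑ^×)`-multiple indeterminacy corresponds precisely to working, in
the case of `G ↷ O^×(G)`, with the underlying ind-topological module equipped with topological group action [cf. (i),
(b)]» [claim: Mochizuki2012, status: disputed] (IUTchII §1 Rmk 1.11.1, kurims p.50); Example 1.8 (iii) p. 38 («a
`Γ`-multiple of the isomorphism … induced by an isomorphism of topological groups `G ⥲ G*`»). abc-iut cell, layer L6,
seat abc-iut-w6-d011 (gen 3), row «RMK1111-II-GENUINE». PROOF-ONLY (no `def` / `structure` / `instance`).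

At the genuine producers `genuineOfModel` / `genuineOfModelIsm` (`O^×(G) = (𝒪_k̄^⊳)ˣ`, `O^⊳(f)` = THE lift `liftM`,
natural `Ẑ^×`-action `Genuine.zhatPowOunits`), combining abc-iut-w6-d010's kernel clause and faithfulness
(`Genuine.exists_eq_zhatPowOunits_of_forget_eq_one`, `zhatPowOunits_injective`, `zhatPowOunits_actOunits`) with this
seat's NATURALITY LAW `O^×(f) ∘ (·)^u = (·)^u ∘ O^×(f)` (`genuineOfModel_unitsMapOtri_zhatPowOunits`, p434885):

* `genuineOfModel_pairIso_iff_exists_zhatPowOunits` — **Rmk 1.11.1 (ii) as a theorem**: for `g : G ⥲ H` and a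
  multiplicative isomorphism `ψ : O^×(G) ⥲ O^×(H)`, «`ψ` is an isomorphism of pairs over `g`» (`ψ(x·m) = g(x)·ψ(m)`)
  IFF «`ψ` is a `Ẑ^×`-multiple of the induced isomorphism»: `ψ = O^×(g) ≫ (·)^u` for some `u ∈ Ẑ^×` — and that `u` is
  UNIQUE (`genuineOfModel_pairIso_zhatPowOunits_unique`);
* `genuineOfModel_pairAut_eq` — every automorphism `(σ, ψ)` of the pair `G ↷ O^×(G)` is `(σ, O^×(σ) ≫ (·)^u)` for a unique
  `u`; `genuineOfModel_pairAutOf_mul` / `_injective` / `_surjective` — **(i) (b) sharpened**: `(σ, u) ↦ (σ, O^×(σ) ≫ (·)^u)`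
  is a BIJECTIVE HOMOMORPHISM `Aut(G) × Ẑ^× → Aut(G ↷ O^×(G))`, i.e. the extension of (i) (b) is split with CENTRAL
  kernel (centrality = the naturality law) — `Aut(G ↷ O^×(G)) ≅ Aut(G) × Ẑ^×` canonically (stated as hom law +
  bijectivity of the explicit map; no new definition);
* the same three statements at the FULLY genuine producer `genuineOfModelIsm` (`rfl`-transport).
HONEST FRAMING: OUR kernel consequences of classical statements ([AbsTopIII] Prop. 3.2 (iv), 3.3 (ii), all inputs
PROVED in the tree); ind-topologies not modelled; nothing here bears on [IUTchIII] Cor. 3.12 or takes a side.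
-/

namespace Literature.IUT.HodgeArakelov

open CategoryTheory
open Literature.AnabelianGeometry.AbsoluteAnabelian

namespace AbsTopMonoids

open Genuine

section Rmk1111ii

variable (S₀ : ThetaSetting.{0}) (C : MLFClosure.{0})
  (ε : S₀.Gk ≃ₜ* (ModelMLFGaloisData.galois C.k C.K).tmPair.Pi)
  (hΔ : ∀ f : S₀.PiX ≃ₜ* S₀.PiX, S₀.DeltaX.map f.toMulEquiv.toMonoidHom = S₀.DeltaX)
  (hq : Nonempty (TopGroup.quot S₀.PiX S₀.DeltaX ≃ₜ* S₀.Gk))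

/-- The induced isomorphism of units `O^×(g)` is an isomorphism of pairs over `g` (interface law
`mapOtri_equivariant`, read on units). [claim: Mochizuki2012, status: disputed] (IUTchII §1 Ex 1.8 (iii), kurims p.38) -/
theorem unitsMapOtri_actOunits {S : ThetaSetting.{0}} (A : AbsTopMonoids S) {G H : IsoClass S.Gk} (g : G ⟶ H)
    (x : G.G) (m : A.Ounits G) :
    Units.mapEquiv (A.mapOtri g) (A.actOunits G x m) = A.actOunits H (IsoClass.homIso g x) (Units.mapEquiv (A.mapOtri g) m) :=
  Units.ext (A.mapOtri_equivariant g x (m : A.Otri G))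

/-- **IUTchII:Rmk1.11.1(ii)** (kurims p. 50 «allowing for a `Γ (= Ẑ^×)`-multiple indeterminacy corresponds precisely to
working … with the underlying ind-topological module equipped with topological group action») AS A THEOREM at the
genuine producer: a multiplicative isomorphism `ψ : O^×(G) ⥲ O^×(H)` intertwines the actions along `g : G ⥲ H` IF AND
ONLY IF it is a `Ẑ^×`-multiple `O^×(g) ≫ (·)^u` of the isomorphism induced by `g` (multiple written on the
`H`-side; the `G`-side reading is the primed version below). (⇒: `ψ ≫ O^×(g)⁻¹` is a pair
automorphism over `1`, hence a `Ẑ^×`-power by (i) (b), and the power commutes past `O^×(g)` by the naturality law;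
⇐: `O^×(g)` is equivariant and `(·)^u` is `G`-linear.) PROVED.
[claim: Mochizuki2012, status: disputed] (IUTchII §1 Rmk 1.11.1 (ii), kurims p.50) -/
theorem genuineOfModel_pairIso_iff_exists_zhatPowOunits {G H : IsoClass S₀.Gk} (g : G ⟶ H)
    (ψ : (genuineOfModel S₀ C ε hΔ hq).Ounits G ≃* (genuineOfModel S₀ C ε hΔ hq).Ounits H) :
    (∀ (x : G.G) (m : (genuineOfModel S₀ C ε hΔ hq).Ounits G),
        ψ ((genuineOfModel S₀ C ε hΔ hq).actOunits G x m) =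
          (genuineOfModel S₀ C ε hΔ hq).actOunits H (IsoClass.homIso g x) (ψ m)) ↔
      ∃ u : ZHatUnits, ψ = (Units.mapEquiv ((genuineOfModel S₀ C ε hΔ hq).mapOtri g)).trans (zhatPowOunits C u) := by
  constructor
  · intro hψ
    -- `ψ₀ := ψ ≫ O^×(g)⁻¹` is an automorphism of the pair `G ↷ O^×(G)` over `1 ∈ Aut(G)`
    let ψ₀ : (genuineOfModel S₀ C ε hΔ hq).Ounits G ≃* (genuineOfModel S₀ C ε hΔ hq).Ounits G :=
      ψ.trans (Units.mapEquiv ((genuineOfModel S₀ C ε hΔ hq).mapOtri g)).symm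
    have hψ₀ : ∀ (x : G.G) (m : (genuineOfModel S₀ C ε hΔ hq).Ounits G),
        ψ₀ ((genuineOfModel S₀ C ε hΔ hq).actOunits G x m) = (genuineOfModel S₀ C ε hΔ hq).actOunits G x (ψ₀ m) := by
      intro x m
      change (Units.mapEquiv ((genuineOfModel S₀ C ε hΔ hq).mapOtri g)).symm
          (ψ ((genuineOfModel S₀ C ε hΔ hq).actOunits G x m)) =
        (genuineOfModel S₀ C ε hΔ hq).actOunits G x
          ((Units.mapEquiv ((genuineOfModel S₀ C ε hΔ hq).mapOtri g)).symm (ψ m))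
      rw [hψ, MulEquiv.symm_apply_eq, unitsMapOtri_actOunits, MulEquiv.apply_symm_apply]
    let p₀ : PairAut G ((genuineOfModel S₀ C ε hΔ hq).Ounits G) ((genuineOfModel S₀ C ε hΔ hq).actOunits G) :=
      ⟨((1 : Aut G), ψ₀), fun x m => hψ₀ x m⟩
    obtain ⟨u, hu⟩ := exists_eq_zhatPowOunits_of_forget_eq_one C S₀ ε hΔ hq G p₀ rfl
    -- `ψ = ψ₀ ≫ O^×(g) = (·)^u ≫ O^×(g) = O^×(g) ≫ (·)^u` (naturality law), pointwise
    -- (no `rw` under compositions typed across `O^×(H) = (𝒪_k̄^⊳)ˣ`: chain the pointwise identities)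
    refine ⟨u, MulEquiv.ext fun m => ?_⟩
    exact (((Units.mapEquiv ((genuineOfModel S₀ C ε hΔ hq).mapOtri g)).apply_symm_apply (ψ m)).symm.trans
      ((congrArg (Units.mapEquiv ((genuineOfModel S₀ C ε hΔ hq).mapOtri g)) (MulEquiv.congr_fun hu m)).trans
        (genuineOfModel_unitsMapOtri_zhatPowOunits C S₀ ε hΔ hq g u m)))
  · rintro ⟨u, rfl⟩ x m
    exact (congrArg (zhatPowOunits C u) (unitsMapOtri_actOunits (genuineOfModel S₀ C ε hΔ hq) g x m)).trans
      (zhatPowOunits_actOunits C S₀ ε hΔ hq H u (IsoClass.homIso g x) _)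

/-- The `Ẑ^×`-multiplier is UNIQUE: `O^×(g) ≫ (·)^u = O^×(g) ≫ (·)^v ⟹ u = v` (faithfulness of the natural `Ẑ^×`-action,
abc-iut-w6-d010's `zhatPowOunits_injective`). PROVED. [claim: Mochizuki2012, status: disputed] (IUTchII §1 Rmk 1.11.1 (ii), kurims p.50) -/
theorem genuineOfModel_pairIso_zhatPowOunits_unique {G H : IsoClass S₀.Gk} (g : G ⟶ H) (u v : ZHatUnits)
    (h : (Units.mapEquiv ((genuineOfModel S₀ C ε hΔ hq).mapOtri g)).trans (zhatPowOunits C u) =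
      (Units.mapEquiv ((genuineOfModel S₀ C ε hΔ hq).mapOtri g)).trans (zhatPowOunits C v)) : u = v := by
  apply zhatPowOunits_injective C
  apply MulEquiv.ext
  intro m
  have h1 : zhatPowOunits C u (Units.mapEquiv ((genuineOfModel S₀ C ε hΔ hq).mapOtri g)
        ((Units.mapEquiv ((genuineOfModel S₀ C ε hΔ hq).mapOtri g)).symm m)) =
      zhatPowOunits C v (Units.mapEquiv ((genuineOfModel S₀ C ε hΔ hq).mapOtri g)
        ((Units.mapEquiv ((genuineOfModel S₀ C ε hΔ hq).mapOtri g)).symm m)) :=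
    MulEquiv.congr_fun h ((Units.mapEquiv ((genuineOfModel S₀ C ε hΔ hq).mapOtri g)).symm m)
  have h2 := (Units.mapEquiv ((genuineOfModel S₀ C ε hΔ hq).mapOtri g)).apply_symm_apply m
  exact (congrArg (zhatPowOunits C u) h2).symm.trans (h1.trans (congrArg (zhatPowOunits C v) h2))

/-- **IUTchII:Rmk1.11.1(ii)**, the same with the `Ẑ^×`-multiple written on the `G`-side (`(·)^u` BEFORE `O^×(g)`): the
two readings of «a `Ẑ^×`-multiple of the induced isomorphism» agree by the naturality law `(·)^u ≫ O^×(g) = O^×(g) ≫ (·)^u`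
(`genuineOfModel_unitsMapOtri_trans_zhatPowOunits`, p434885). PROVED.
[claim: Mochizuki2012, status: disputed] (IUTchII §1 Rmk 1.11.1 (ii), kurims p.50) -/
theorem genuineOfModel_pairIso_iff_exists_zhatPowOunits' {G H : IsoClass S₀.Gk} (g : G ⟶ H)
    (ψ : (genuineOfModel S₀ C ε hΔ hq).Ounits G ≃* (genuineOfModel S₀ C ε hΔ hq).Ounits H) :
    (∀ (x : G.G) (m : (genuineOfModel S₀ C ε hΔ hq).Ounits G),
        ψ ((genuineOfModel S₀ C ε hΔ hq).actOunits G x m) =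
          (genuineOfModel S₀ C ε hΔ hq).actOunits H (IsoClass.homIso g x) (ψ m)) ↔
      ∃ u : ZHatUnits, ψ = (zhatPowOunits C u).trans (Units.mapEquiv ((genuineOfModel S₀ C ε hΔ hq).mapOtri g)) := by
  refine (genuineOfModel_pairIso_iff_exists_zhatPowOunits S₀ C ε hΔ hq g ψ).trans (exists_congr fun u => ?_)
  constructor
  · exact fun h => h.trans (genuineOfModel_unitsMapOtri_trans_zhatPowOunits C S₀ ε hΔ hq g u).symm
  · exact fun h => h.trans (genuineOfModel_unitsMapOtri_trans_zhatPowOunits C S₀ ε hΔ hq g u)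

/-- **IUTchII:Rmk1.11.1(i) (b)**, sharpened at the genuine producer: EVERY automorphism `(σ, ψ)` of the pair
`G ↷ O^×(G)` is `(σ, O^×(σ) ≫ (·)^u)` for a (unique) `u ∈ Ẑ^×` — the surjection onto `Aut(G)` of (i) (b) is SPLIT by
`σ ↦ (σ, O^×(σ))` and its kernel is the natural `Ẑ^×`-action. PROVED.
[claim: Mochizuki2012, status: disputed] (IUTchII §1 Rmk 1.11.1 (i), kurims p.50) -/
theorem genuineOfModel_pairAut_eq (G : IsoClass S₀.Gk)
    (p : PairAut G ((genuineOfModel S₀ C ε hΔ hq).Ounits G) ((genuineOfModel S₀ C ε hΔ hq).actOunits G)) :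
    ∃ u : ZHatUnits, p.1.2 =
      (Units.mapEquiv ((genuineOfModel S₀ C ε hΔ hq).mapOtri (PairAut.forget p).hom)).trans (zhatPowOunits C u) :=
  (genuineOfModel_pairIso_iff_exists_zhatPowOunits S₀ C ε hΔ hq (PairAut.forget p).hom p.1.2).1 p.2

/-- The pair automorphism `(σ, O^×(σ) ≫ (·)^u)` attached to `(σ, u) ∈ Aut(G) × Ẑ^×` IS an automorphism of
`G ↷ O^×(G)` (membership). PROVED. [claim: Mochizuki2012, status: disputed] (IUTchII §1 Rmk 1.11.1 (i), kurims p.50) -/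
theorem genuineOfModel_pairAutOf_mem (G : IsoClass S₀.Gk) (σ : Aut G) (u : ZHatUnits) :
    ((σ, (Units.mapEquiv ((genuineOfModel S₀ C ε hΔ hq).mapOtri σ.hom)).trans (zhatPowOunits C u)) :
        Aut G × MulAut ((genuineOfModel S₀ C ε hΔ hq).Ounits G)) ∈
      PairAut G ((genuineOfModel S₀ C ε hΔ hq).Ounits G) ((genuineOfModel S₀ C ε hΔ hq).actOunits G) :=
  (genuineOfModel_pairIso_iff_exists_zhatPowOunits S₀ C ε hΔ hq σ.hom _).2 ⟨u, rfl⟩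

/-- **`Aut(G ↷ O^×(G)) = Aut(G) × Ẑ^×`, homomorphism law**: `(σ, O^×(σ) ≫ (·)^u) · (τ, O^×(τ) ≫ (·)^v) =
(στ, O^×(στ) ≫ (·)^{uv})` — the `Ẑ^×`-powers commute past the induced isomorphisms (the naturality law: the kernel
`Ẑ^×` of (i) (b) is CENTRAL) and compose by the functor law `mapOtri_comp`. PROVED.
[claim: Mochizuki2012, status: disputed] (IUTchII §1 Rmk 1.11.1 (i), kurims p.50) -/
theorem genuineOfModel_pairAutOf_mul (G : IsoClass S₀.Gk) (σ τ : Aut G) (u v : ZHatUnits) :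
    ((σ, (Units.mapEquiv ((genuineOfModel S₀ C ε hΔ hq).mapOtri σ.hom)).trans (zhatPowOunits C u)) :
        Aut G × MulAut ((genuineOfModel S₀ C ε hΔ hq).Ounits G)) *
      ((τ, (Units.mapEquiv ((genuineOfModel S₀ C ε hΔ hq).mapOtri τ.hom)).trans (zhatPowOunits C v)) :
        Aut G × MulAut ((genuineOfModel S₀ C ε hΔ hq).Ounits G)) =
      ((σ * τ, (Units.mapEquiv ((genuineOfModel S₀ C ε hΔ hq).mapOtri (σ * τ).hom)).trans
          (zhatPowOunits C (u * v))) : Aut G × MulAut ((genuineOfModel S₀ C ε hΔ hq).Ounits G)) := by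
  refine Prod.ext rfl (MulEquiv.ext fun m => ?_)
  -- pointwise: `(O^×(τ) ≫ (·)^v ≫ O^×(σ) ≫ (·)^u) m = (·)^{uv} (O^×(τ ≫ σ) m)` — naturality, then `map_mul`, then the
  -- functor law (chained identities; no `rw` under compositions typed across `O^×(G) = (𝒪_k̄^⊳)ˣ`)
  have h₁ := genuineOfModel_unitsMapOtri_zhatPowOunits C S₀ ε hΔ hq σ.hom v
    (Units.mapEquiv ((genuineOfModel S₀ C ε hΔ hq).mapOtri τ.hom) m)
  have h₂ : ∀ z : (nonzeroIntegers C.k C.K)ˣ,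
      zhatPowOunits C u (zhatPowOunits C v z) = zhatPowOunits C (u * v) z := fun z => by
    rw [map_mul, MulAut.mul_apply]
  have h₃ : Units.mapEquiv ((genuineOfModel S₀ C ε hΔ hq).mapOtri σ.hom)
        (Units.mapEquiv ((genuineOfModel S₀ C ε hΔ hq).mapOtri τ.hom) m) =
      Units.mapEquiv ((genuineOfModel S₀ C ε hΔ hq).mapOtri (τ.hom ≫ σ.hom)) m :=
    Units.ext (by
      rw [Units.coe_mapEquiv, Units.coe_mapEquiv, Units.coe_mapEquiv, (genuineOfModel S₀ C ε hΔ hq).mapOtri_comp,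
        MulEquiv.trans_apply])
  exact (congrArg (zhatPowOunits C u) h₁).trans ((h₂ _).trans (congrArg (zhatPowOunits C (u * v)) h₃))

/-- **`Aut(G ↷ O^×(G)) = Aut(G) × Ẑ^×`, injectivity**: `(σ, O^×(σ) ≫ (·)^u)` determines `(σ, u)`. PROVED.
[claim: Mochizuki2012, status: disputed] (IUTchII §1 Rmk 1.11.1 (i), kurims p.50) -/
theorem genuineOfModel_pairAutOf_injective (G : IsoClass S₀.Gk) :
    Function.Injective fun σu : Aut G × ZHatUnits =>
      (⟨(σu.1, (Units.mapEquiv ((genuineOfModel S₀ C ε hΔ hq).mapOtri σu.1.hom)).trans (zhatPowOunits C σu.2)),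
          genuineOfModel_pairAutOf_mem S₀ C ε hΔ hq G σu.1 σu.2⟩ :
        PairAut G ((genuineOfModel S₀ C ε hΔ hq).Ounits G) ((genuineOfModel S₀ C ε hΔ hq).actOunits G)) := by
  rintro ⟨σ, u⟩ ⟨τ, v⟩ h
  have h1 : ((σ, (Units.mapEquiv ((genuineOfModel S₀ C ε hΔ hq).mapOtri σ.hom)).trans (zhatPowOunits C u)) :
        Aut G × MulAut ((genuineOfModel S₀ C ε hΔ hq).Ounits G)) =
      (τ, (Units.mapEquiv ((genuineOfModel S₀ C ε hΔ hq).mapOtri τ.hom)).trans (zhatPowOunits C v)) :=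
    congrArg Subtype.val h
  obtain ⟨hστ, hψ⟩ := Prod.mk.inj h1
  subst hστ
  exact Prod.ext rfl (genuineOfModel_pairIso_zhatPowOunits_unique S₀ C ε hΔ hq σ.hom u v hψ)

/-- **`Aut(G ↷ O^×(G)) = Aut(G) × Ẑ^×`, surjectivity**: every automorphism of the pair `G ↷ O^×(G)` is
`(σ, O^×(σ) ≫ (·)^u)` — together with `_mul` and `_injective`: `(σ, u) ↦ (σ, O^×(σ) ≫ (·)^u)` is an ISOMORPHISM of groups
`Aut(G) × Ẑ^× ⥲ Aut(G ↷ O^×(G))` (Rmk 1.11.1 (i) (b): surjection onto `Aut(G)` with kernel `Ẑ^×`, here split and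
central). PROVED. [claim: Mochizuki2012, status: disputed] (IUTchII §1 Rmk 1.11.1 (i), kurims p.50) -/
theorem genuineOfModel_pairAutOf_surjective (G : IsoClass S₀.Gk) :
    Function.Surjective fun σu : Aut G × ZHatUnits =>
      (⟨(σu.1, (Units.mapEquiv ((genuineOfModel S₀ C ε hΔ hq).mapOtri σu.1.hom)).trans (zhatPowOunits C σu.2)),
          genuineOfModel_pairAutOf_mem S₀ C ε hΔ hq G σu.1 σu.2⟩ :
        PairAut G ((genuineOfModel S₀ C ε hΔ hq).Ounits G) ((genuineOfModel S₀ C ε hΔ hq).actOunits G)) := by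
  intro p
  obtain ⟨u, hu⟩ := genuineOfModel_pairAut_eq S₀ C ε hΔ hq G p
  exact ⟨(PairAut.forget p, u), Subtype.ext (Prod.ext rfl hu.symm)⟩

end Rmk1111ii

/-! ## The same at the FULLY GENUINE producer `genuineOfModelIsm` (`O^×`, its `G`-action and `O^×(f)` are those of
`genuineOfModel` definitionally: `genuineOfModelIsm_actOtri`, `genuineOfModelIsm_mapOtri`) -/

section Rmk1111iiIsm

variable (S₀ : ThetaSetting.{0}) (C : MLFClosure.{0})
  (ε : S₀.Gk ≃ₜ* (ModelMLFGaloisData.galois C.k C.K).tmPair.Pi)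
  (hΔ : ∀ f : S₀.PiX ≃ₜ* S₀.PiX, S₀.DeltaX.map f.toMulEquiv.toMonoidHom = S₀.DeltaX)
  (hq : Nonempty (TopGroup.quot S₀.PiX S₀.DeltaX ≃ₜ* S₀.Gk))

/-- **IUTchII:Rmk1.11.1(ii)** at `genuineOfModelIsm`: `ψ : O^×(G) ⥲ O^×(H)` is an isomorphism of pairs over `g` iff
`ψ = O^×(g) ≫ (·)^u` for some `u ∈ Ẑ^×`. PROVED. [claim: Mochizuki2012, status: disputed] (IUTchII §1 Rmk 1.11.1 (ii), kurims p.50) -/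
theorem genuineOfModelIsm_pairIso_iff_exists_zhatPowOunits {G H : IsoClass S₀.Gk} (g : G ⟶ H)
    (ψ : (genuineOfModelIsm S₀ C ε hΔ hq).Ounits G ≃* (genuineOfModelIsm S₀ C ε hΔ hq).Ounits H) :
    (∀ (x : G.G) (m : (genuineOfModelIsm S₀ C ε hΔ hq).Ounits G),
        ψ ((genuineOfModelIsm S₀ C ε hΔ hq).actOunits G x m) =
          (genuineOfModelIsm S₀ C ε hΔ hq).actOunits H (IsoClass.homIso g x) (ψ m)) ↔
      ∃ u : ZHatUnits, ψ = (Units.mapEquiv ((genuineOfModelIsm S₀ C ε hΔ hq).mapOtri g)).trans (zhatPowOunits C u) :=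
  genuineOfModel_pairIso_iff_exists_zhatPowOunits S₀ C ε hΔ hq g ψ

/-- **IUTchII:Rmk1.11.1(i) (b)** sharpened at `genuineOfModelIsm`: every automorphism of the pair `G ↷ O^×(G)` is
`(σ, O^×(σ) ≫ (·)^u)`. PROVED. [claim: Mochizuki2012, status: disputed] (IUTchII §1 Rmk 1.11.1 (i), kurims p.50) -/
theorem genuineOfModelIsm_pairAut_eq (G : IsoClass S₀.Gk)
    (p : PairAut G ((genuineOfModelIsm S₀ C ε hΔ hq).Ounits G) ((genuineOfModelIsm S₀ C ε hΔ hq).actOunits G)) :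
    ∃ u : ZHatUnits, p.1.2 =
      (Units.mapEquiv ((genuineOfModelIsm S₀ C ε hΔ hq).mapOtri (PairAut.forget p).hom)).trans (zhatPowOunits C u) :=
  genuineOfModel_pairAut_eq S₀ C ε hΔ hq G p

/-- **`Aut(G ↷ O^×(G)) = Aut(G) × Ẑ^×`** at `genuineOfModelIsm`: `(σ, u) ↦ (σ, O^×(σ) ≫ (·)^u)` is a bijection onto
the pair automorphisms (hom law: `genuineOfModel_pairAutOf_mul`, verbatim). PROVED.
[claim: Mochizuki2012, status: disputed] (IUTchII §1 Rmk 1.11.1 (i), kurims p.50) -/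
theorem genuineOfModelIsm_pairAutOf_bijective (G : IsoClass S₀.Gk) :
    Function.Bijective fun σu : Aut G × ZHatUnits =>
      (⟨(σu.1, (Units.mapEquiv ((genuineOfModelIsm S₀ C ε hΔ hq).mapOtri σu.1.hom)).trans (zhatPowOunits C σu.2)),
          genuineOfModel_pairAutOf_mem S₀ C ε hΔ hq G σu.1 σu.2⟩ :
        PairAut G ((genuineOfModelIsm S₀ C ε hΔ hq).Ounits G) ((genuineOfModelIsm S₀ C ε hΔ hq).actOunits G)) :=
  ⟨genuineOfModel_pairAutOf_injective S₀ C ε hΔ hq G, genuineOfModel_pairAutOf_surjective S₀ C ε hΔ hq G⟩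

end Rmk1111iiIsm

end AbsTopMonoids

end Literature.IUT.HodgeArakelov
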